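/-
Copyright (c) 2026. All rights reserved.
Released under Apache 2.0 license as described in the file LICENSE.
-/
import Literature.NumberTheory.GaloisRepresentations.HOneRestrictionOntoInvariants
import Literature.NumberTheory.GaloisRepresentations.LocalFieldInertiaCdOne
import Literature.AnabelianGeometry.AbsoluteAnabelian.FreeProcyclicHOneEval
import Literature.AnabelianGeometry.AbsoluteAnabelian.LocalUnramifiedQuotientH2
import HarnessLib

/-!
# `H¹(G, B) → H¹(N, B)^{G/N}` is onto for FINITE discrete `B` and `G ⧸ N` free procyclic;
# `H¹(F, B) ↠ H¹(I_F, B)^{Fr}` for a non-archimedean local field `F`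

Topic `NumberTheory/GaloisRepresentations`; namespace `Literature.NumberTheory.GaloisRepresentations`.
THEOREMS ONLY (no definition, no named fact).  Sequel of `HOneRestrictionOntoInvariants.lean`, whose
surjectivity theorem `exists_resSubgroup_eq_of_conjMap_eq_of_isFreeProcyclic` is stated under the
hypothesis (KM4): every `t ∈ X` is the value at the generator `φ` of a continuous cocycle of the
procyclic complement `C = cl⟨φ⟩`.  Here (KM4) is DISCHARGED for finite discrete coefficients:

* `exists_contOneCocycles_apply_eq_of_finite` — for a closed subgroup `C` of a profinite group
  topologically generated by `ψ` and with an open subgroup of every positive index, and `B` a finite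
  discrete `G`-module, every `t ∈ B` is `y(ψ)` for a continuous cocycle `y` of `C` (the tree's
  `H¹(C, B) ⥲ B/(ψ − 1)B`, `evalMod_bijective_of_dense_zpowers`, plus a coboundary correction);
* **`exists_resSubgroup_eq_of_conjMap_eq_of_finite`**, `exists_resSubgroup_eq_iff_forall_conjMap_eq_of_finite`
  — for `G` profinite, `N ⊴ G` closed with `G ⧸ N` free procyclic (`≅ Ẑ`) and `B` finite discrete:
  **`res : H¹(G, B) → H¹(N, B)^{G/N}` is surjective**, i.e. the sequence
  `0 → H¹(G/N, B^N) → H¹(G, B) → H¹(N, B)^{G/N} → 0` is exact on the right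
  (Neukirch–Schmidt–Wingberg (1.6.7) with `H²(Ẑ, B^N) = 0`; the tree had this only numerically,
  `HochschildSerreLowDegree.natCard_one_eq_mul`, and for `ℤ_p`-quotients, `ZpDescent`);
* **`exists_resSubgroup_absInertia_eq_of_conjMap_eq`**,
  `exists_resSubgroup_absInertia_eq_iff_forall_conjMap_eq` — for a non-archimedean local field `F`,
  `I_F = absInertia F` and a finite discrete `Γ_F`-module `B`: **every Frobenius-invariant class of
  `H¹(I_F, B)` is the restriction of a class of `H¹(F, B)`** — the right end of
  `0 → H¹(F^nr/F, B^{I_F}) → H¹(F, B) → H¹(I_F, B)^{Fr} → 0` (Rubin, *Euler Systems*, Lemma 1.3.2 (i) /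
  App. B; Milne, *ADT* I Lemma 2.9 proof; Büyükboduk, JNT 129 (2009) §2.1.2), the finite-level form of
  the local index `[H¹(F, B) : H¹_ur(F, B)] = #H¹(I_F, B)^{Fr}` used by Kolyvagin-system arguments at bad
  places (Mazur–Rubin, Remark A.5).

Inputs: `isFreeProcyclic_quotient_galUnr` (`Gal(F^nr/F) ≅ Ẑ`), `dense_zpowers_mk_of_isFrobPow`,
`galUnr_eq_absInertia`.
-/

noncomputable section

open CategoryTheory

universe u

namespace Literature.NumberTheory.GaloisRepresentations

open Literature.AnabelianGeometry.AbsoluteAnabelian Literature.GroupTheory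
open _root_.Subgroup _root_.Topology

/-! ### (KM4) for finite discrete coefficients -/

section Finite

variable {G : Type u} [Group G] [TopologicalSpace G] [IsTopologicalGroup G] [CompactSpace G]
  [T2Space G] [TotallyDisconnectedSpace G]
variable {B : Type u} [AddCommGroup B] [TopologicalSpace B] [DiscreteTopology B] [Finite B]

omit [T2Space G] in
/-- **(KM4) for finite discrete coefficients**: if the closed subgroup `C ≤ G` is topologically
generated by `ψ` and has an open subgroup of every positive index (`C ≅ Ẑ`), then every `t ∈ B` is
the value at `ψ` of a continuous `1`-cocycle of `C` with values in the finite discrete module `B`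
(`H¹(C, B) → B/(ψ − 1)B` is onto, and one corrects by a coboundary).
[cite: SerreLocalFields1979, XIII §1 Prop. 1] -/
theorem exists_contOneCocycles_apply_eq_of_finite (τ : ContinuousRep G ℤ B) (C : Subgroup G)
    (hC : IsClosed (C : Set G)) {ψ : C} (hdense : Dense (zpowers ψ : Set C))
    (hidx : ∀ n : ℕ, 0 < n → ∃ H : Subgroup C, IsOpen (H : Set C) ∧ H.index = n) (t : B) :
    ∃ y : contOneCocycles (subgroupRep τ.toTopRep C), y.1 ψ = t := by
  haveI : CompactSpace C := isCompact_iff_compactSpace.mp hC.isCompact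
  let τC : ContinuousRep C ℤ B := τ.restrict (subgroupIncl C)
  obtain ⟨c, hc⟩ := (evalMod_bijective_of_dense_zpowers hdense hidx τC).2 (QuotientAddGroup.mk t)
  obtain ⟨z, rfl⟩ := oneCocycleClass_surjective _ c
  rw [evalMod_oneCocycleClass, QuotientAddGroup.eq, mem_subOneRange_iff] at hc
  obtain ⟨v, hv⟩ := hc
  refine ⟨z + coboundaryCocycle τC v, ?_⟩
  change z.1 ψ + (τC ψ v - v) = t
  rw [hv]; abel

/-- **`res : H¹(G, B) → H¹(N, B)` is onto the invariant classes** for `G` profinite, `N ⊴ G` closed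
with `G ⧸ N` free procyclic and `B` a finite discrete `G`-module: every class fixed by (a lift `φ` of)
the topological generator is a restriction.
[cite: NeukirchSchmidtWingberg2008, (1.6.7)] [cite: SerreGaloisCohomology1997, I §2.6 (b)] -/
theorem exists_resSubgroup_eq_of_conjMap_eq_of_finite (τ : ContinuousRep G ℤ B) (N : Subgroup G)
    [N.Normal] (hN : IsClosed (N : Set G)) (hfree : FundamentalExtension.IsFreeProcyclic (G ⧸ N))
    (φ : G) (hφ : Dense (zpowers (QuotientGroup.mk φ : G ⧸ N) : Set (G ⧸ N)))
    (yc : continuousCohomology 1 (subgroupRep τ.toTopRep N)) (hinv : conjMap τ.toTopRep N φ 1 yc = yc) :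
    ∃ xc : continuousCohomology 1 τ.toTopRep, resSubgroup τ.toTopRep N 1 xc = yc :=
  exists_resSubgroup_eq_of_conjMap_eq_of_isFreeProcyclic τ.toTopRep τ.continuous_smul N hN hfree φ hφ
    (exists_contOneCocycles_apply_eq_of_finite τ _ (isClosed_topologicalClosure _)
      (dense_zpowers_mk_topologicalClosure' φ)
      (exists_isOpen_index_topologicalClosure_zpowers N hN hfree φ hφ))
    yc hinv

/-- **`range res = H¹(N, B)^{G}`** for `B` finite discrete and `G ⧸ N` free procyclic: a class of
`H¹(N, B)` is restricted from `G` iff it is `G`-invariant — exactness of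
`0 → H¹(G/N, B^N) → H¹(G, B) → H¹(N, B)^{G/N} → 0` on the right.
[cite: NeukirchSchmidtWingberg2008, (1.6.7)] [cite: SerreGaloisCohomology1997, I §2.6 (b)] -/
theorem exists_resSubgroup_eq_iff_forall_conjMap_eq_of_finite (τ : ContinuousRep G ℤ B)
    (N : Subgroup G) [N.Normal] (hN : IsClosed (N : Set G))
    (hfree : FundamentalExtension.IsFreeProcyclic (G ⧸ N))
    (yc : continuousCohomology 1 (subgroupRep τ.toTopRep N)) :
    (∃ xc : continuousCohomology 1 τ.toTopRep, resSubgroup τ.toTopRep N 1 xc = yc) ↔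
      ∀ g : G, conjMap τ.toTopRep N g 1 yc = yc := by
  obtain ⟨γ, hγ⟩ := hfree.exists_dense_zpowers
  obtain ⟨φ, rfl⟩ := QuotientGroup.mk_surjective γ
  exact exists_resSubgroup_eq_iff_forall_conjMap_eq_of_isFreeProcyclic τ.toTopRep τ.continuous_smul N hN
    hfree φ hγ
    (exists_contOneCocycles_apply_eq_of_finite τ _ (isClosed_topologicalClosure _)
      (dense_zpowers_mk_topologicalClosure' φ)
      (exists_isOpen_index_topologicalClosure_zpowers N hN hfree φ hγ)) yc

end Finite

/-! ### Local fields: `H¹(F, B) ↠ H¹(I_F, B)^{Fr}` -/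

section Local

open Field IsNonarchimedeanLocalField

variable (F : Type u) [Field F] [ValuativeRel F] [TopologicalSpace F] [IsNonarchimedeanLocalField F]
variable {B : Type u} [AddCommGroup B] [TopologicalSpace B] [DiscreteTopology B] [Finite B]

/-- Transport of free procyclicity of a quotient along an equality of normal subgroups. [folklore] -/
private theorem isFreeProcyclic_quotient_congr' {G : Type*} [Group G] [TopologicalSpace G]
    {A A' : Subgroup G} [A.Normal] [A'.Normal] (h : A = A')
    (hf : FundamentalExtension.IsFreeProcyclic (G ⧸ A)) : FundamentalExtension.IsFreeProcyclic (G ⧸ A') := by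
  subst h; exact hf

/-- Transport of density of `⟨φ̄⟩` along an equality of normal subgroups. [folklore] -/
private theorem dense_zpowers_mk_congr {G : Type*} [Group G] [TopologicalSpace G]
    {A A' : Subgroup G} [A.Normal] [A'.Normal] (h : A = A') {φ : G}
    (hφ : Dense (zpowers (QuotientGroup.mk φ : G ⧸ A) : Set (G ⧸ A))) :
    Dense (zpowers (QuotientGroup.mk φ : G ⧸ A') : Set (G ⧸ A')) := by
  subst h; exact hφ

/-- **`Γ_F ⧸ I_F ≅ Ẑ` is free procyclic** (with `I_F = absInertia F`; transport of the tree's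
`isFreeProcyclic_quotient_galUnr` along `galUnr_eq_absInertia`, any universe).
[cite: NeukirchSchmidtWingberg2008, Thm. 7.5.3] -/
theorem isFreeProcyclic_quotient_absInertia' [(absInertia F).Normal] :
    FundamentalExtension.IsFreeProcyclic (absoluteGaloisGroup F ⧸ absInertia F) := by
  haveI : (galUnr F).Normal := by rw [galUnr_eq_absInertia]; infer_instance
  exact isFreeProcyclic_quotient_congr' (galUnr_eq_absInertia (F := F)) (isFreeProcyclic_quotient_galUnr F)

/-- **A Frobenius topologically generates `Γ_F ⧸ I_F`** (with `I_F = absInertia F`).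
[cite: NeukirchSchmidtWingberg2008, Thm. 7.5.3] -/
theorem dense_zpowers_mk_absInertia_of_isFrobPow [(absInertia F).Normal] {φ : absoluteGaloisGroup F}
    (hφ : IsFrobPow φ 1) :
    Dense (zpowers (QuotientGroup.mk φ : absoluteGaloisGroup F ⧸ absInertia F) :
      Set (absoluteGaloisGroup F ⧸ absInertia F)) := by
  haveI : (galUnr F).Normal := by rw [galUnr_eq_absInertia]; infer_instance
  exact dense_zpowers_mk_congr (galUnr_eq_absInertia (F := F)) (dense_zpowers_mk_of_isFrobPow hφ)

/-- **`H¹(F, B) → H¹(I_F, B)^{Fr}` is surjective**: for a non-archimedean local field `F`, its inertia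
group `I_F = absInertia F`, a finite discrete `Γ_F`-module `B` and any arithmetic Frobenius lift `φ`
(`IsFrobPow φ 1`), every class of `H¹(I_F, B)` fixed by `φ` is the restriction of a class of
`H¹(F, B) = H¹(Γ_F, B)` — the right end of the exact sequence
`0 → H¹(F^nr/F, B^{I_F}) → H¹(F, B) → H¹(I_F, B)^{Fr} → 0` (`cd Ẑ = 1`).
[cite: Rubin2000, Lemma 1.3.2] [cite: MilneADT2006, I §2 Lemma 2.9 (proof)] -/
theorem exists_resSubgroup_absInertia_eq_of_conjMap_eq
    (τ : ContinuousRep (absoluteGaloisGroup F) ℤ B) {φ : absoluteGaloisGroup F} (hφ : IsFrobPow φ 1)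
    (yc : continuousCohomology 1 (subgroupRep τ.toTopRep (absInertia F)))
    (hinv : haveI : (absInertia F).Normal := absInertia_normal_holds F
      conjMap τ.toTopRep (absInertia F) φ 1 yc = yc) :
    ∃ xc : continuousCohomology 1 τ.toTopRep, resSubgroup τ.toTopRep (absInertia F) 1 xc = yc := by
  haveI := absoluteGaloisGroup_compactSpace F
  haveI : (absInertia F).Normal := absInertia_normal_holds F
  exact exists_resSubgroup_eq_of_conjMap_eq_of_finite τ (absInertia F) (isClosed_absInertia_holds F)
    (isFreeProcyclic_quotient_absInertia' F) φ (dense_zpowers_mk_absInertia_of_isFrobPow F hφ) yc hinv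

/-- **`range (H¹(F, B) → H¹(I_F, B)) = H¹(I_F, B)^{Γ_F}`** for finite discrete `B`: a class of
`H¹(I_F, B)` is restricted from `Γ_F` iff it is `Γ_F`-invariant.
[cite: Rubin2000, Lemma 1.3.2] [cite: NeukirchSchmidtWingberg2008, (1.6.7)] -/
theorem exists_resSubgroup_absInertia_eq_iff_forall_conjMap_eq
    (τ : ContinuousRep (absoluteGaloisGroup F) ℤ B)
    (yc : continuousCohomology 1 (subgroupRep τ.toTopRep (absInertia F))) :
    (∃ xc : continuousCohomology 1 τ.toTopRep, resSubgroup τ.toTopRep (absInertia F) 1 xc = yc) ↔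
      ∀ g : absoluteGaloisGroup F, haveI : (absInertia F).Normal := absInertia_normal_holds F
        conjMap τ.toTopRep (absInertia F) g 1 yc = yc := by
  haveI := absoluteGaloisGroup_compactSpace F
  haveI : (absInertia F).Normal := absInertia_normal_holds F
  exact exists_resSubgroup_eq_iff_forall_conjMap_eq_of_finite τ (absInertia F) (isClosed_absInertia_holds F)
    (isFreeProcyclic_quotient_absInertia' F) yc

end Local

end Literature.NumberTheory.GaloisRepresentations

end
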